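import Summits.AtomisticToContinuum.FouriersLaw.Theses.CageBudgetFekete
import Literature.MathematicalPhysics.KineticTheory.ZeroWavenumberSpace

/-!
# Line `relay` of crux `CageBudgetFekete.UnboundedHeatVariance`
(item `stmt-AtomisticToContinuum-15771`, route `route-AtomisticToContinuum-CageBudgetFekete`, rank 4,
sub-problem `FouriersLaw`; crux-strategist `planner-cstrat-stmt-AtomisticToContinuum-15771-b1-0`, 2026-08-17)

Crux (FIXED, concluded BY NAME below): in the route's arena (pinned chain `pinnedChain ω₂ lam β γ`,
`ω₂, lam, β > 0`, `T > 0`, shift- and reversal-invariant DLR state `μ`, `μ`-preserving shift-covariant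
`InfiniteChainDynamics D`, absolutely convergent summed current correlations `C = D.currentCorrelation μ`,
`C` continuous) the equilibrium heat variance `V(τ) = 2∫₀^τ (τ - s) C(s) ds` is unbounded:
`∀ R ∃ τ ≥ 0, R < V τ`.

## The line: ENERGY SIDE, REAL SPACE — "bond heat must be relayed"

Objects (all inline over tree declarations): the single-bond integrated current (heat through bond 0)
`Q₀(τ)(σ) = ∫₀^τ j₀(φ_s σ) ds` (`j = OscillatorChain.bondCurrentZ`), its variance
`v(τ) = ∫ Q₀(τ)² dμ` (the SINGLE-BOND HEAT VARIANCE), and the block energies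
`H_L = Σ_{|x| ≤ L} h_x` (`h = OscillatorChain.energyDensityZ`, whose local conservation law
`ḣ_x = j_{x-1} - j_x` along solutions is LANDED: `IsSolution.hasDerivAt_energyDensityZ`).

* `stub_blockEnergyCaging` (S1, CALCULUS FROM NEWTON; size L, provable): `H_L ∈ L²(μ)` and
  `‖H_L ∘ φ_τ - H_L‖²_{L²(μ)} ≤ 4 v(τ)` for every `L` and `τ ≥ 0` — integrating the conservation law
  along the a.e. genuine orbits gives `H_L∘φ_τ - H_L = Q_{-L-1}(τ) - Q_L(τ)` (TWO boundary bonds,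
  whatever `L`), and `‖Q_x(τ)‖ = ‖Q₀(τ)‖` by shift invariance / a.e. shift covariance. This is where the
  line USES that orbits solve the equations of motion (`Negative/LoadBearing`:
  `unboundedHeatVariance_false_without_carrierAE`) and that `μ` is Gibbs (all moments of `h_x`, `j_x` by
  `hasSuperstabilityEstimate_of_isShiftInvariant_pinnedChain`; `…_false_without_gibbs`).
* `stub_invariantNearCagedObservable` (S2, KOOPMAN GEOMETRY; size M, provable, general): for ANY
  `μ`-preserving infinite-chain dynamics and `f ∈ L²(μ)` whose forward increments are caged,
  `sup_{τ ≥ 0} ‖f∘φ_τ - f‖² ≤ δ`, there is a flow-invariant `g ∈ L²(μ)` with `‖f - g‖² ≤ δ`: the point of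
  minimal norm of the closed convex hull of the forward Koopman orbit `{f∘φ_τ : τ ≥ 0}` (the hull lies in
  the closed `√δ`-ball about `f`, is mapped into itself by every Koopman isometry `U_s`, `s ≥ 0`, and its
  minimal-norm point is unique, hence fixed). No mean-ergodic theorem, no strong continuity needed.
* `stub_noFrozenBlockEnergy` (S3, THE ERGODIC INPUT; open): block energies are NOT approximable within
  `O(1)` in `L²(μ)` by flow-invariant `L²` functions, uniformly in the block: `∀ M ∃ L`, every invariant
  `g ∈ L²(μ)` has `‖H_L - g‖² > M` (equivalently `dist(H_L, Fix U)² = Var(H_L) - Var(E[H_L | ℐ])` is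
  unbounded in `L`: no EXTENSIVE FROZEN ENERGY / no complete family of quasi-local `L²` integrals of
  motion). Weaker than ergodicity of `(μ_T, φ)` (trivial `ℐ` gives `‖H_L - g‖² ≥ Var H_L ≍ L`); it is the
  metric (`L²(μ_T)`) cousin — not a consequence — of the catalogued `MacroErgodicityHypothesis`
  (invariant MEASURES); true at the harmonic member (Lanford–Lebowitz: Lebesgue spectrum), false exactly
  for insulators (Anderson / asymptotically localised chains, where `H_L` is `O(1)`-close to the sum of
  localised mode energies).
* `stub_crossBondHeatCovariance` (S4, TRANSPORT GEOMETRY; open, kit-falsifiable): the single-bond heat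
  variance is affinely dominated by the total one, `∃ K ∀ τ ≥ 0, v(τ) ≤ K (1 + V(τ))`. Since
  `V(τ) - v(τ) = Σ_{x ≠ 0} Cov(Q₀(τ), Q_x(τ))` (Green–Kubo–Helfand bond decomposition) this says the NET
  cross-bond heat-transfer covariance is not more negative than `-(K-1)v - K`: transmission is not
  overwhelmed by 'sloshing'. In the spreading-profile form `v = Σ_d |d| ΔS(d,τ)`, `V = Σ_d d² ΔS(d,τ)`
  (`ΔS(d,τ) = S(d,τ) - S(d,0)`, `S` the energy–energy structure function; Mendl–Spohn 2015 (4.6),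
  Helfand 1960) it follows from the DEP sign conjecture `S ≥ 0` (card dynamical-energy-positivity-dep)
  with the STATIC constant `K = 1 + Σ_{|d| ≥ 2}(d² - |d|) S(d,0)`; it holds in the harmonic (Isserlis),
  kinetic (positive phonon Boltzmann kernel) and hydrodynamic (heat kernel: `V - v → +∞`) regimes.

COMPOSITION `UnboundedHeatVariance_of` (sorry-free, pure logic + linear arithmetic): if `V ≤ R` on
`τ ≥ 0` then `v ≤ K(1+R)` (S4), so every block energy has caged increments `≤ 4K(1+R)` (S1), hence is
within `4K(1+R)` of an invariant `L²` function (S2) for EVERY `L` — contradicting S3 at `M = 4K(1+R)`.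

Why not a costume / not shredded: S1 and S2 hold for conductors AND insulators; S3 is a statement about
the EVEN (energy) sector with no current in it and is not implied by U (a frozen extensive component can
coexist with a conducting one); S4 holds trivially for insulators (both sides bounded). No stub mentions
unboundedness of `V`; BC3-type probes `stub → UnboundedHeatVariance`, `stub → FouriersLaw` fail (card).
Difference from line `birth` (spectral: Bochner measure of the TOTAL current, infrared charge = U
restated): here the open content is split into an ergodic statement on block ENERGIES (S3) and a
covariance inequality between the single-bond and total heat variances (S4), glued by the landed local
conservation law; the single-bond heat variance `v` is the relay.

Disproof used: no `Disproof.lean` on file for this crux (2026-08-17); honours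
`Theorems/UnboundedHeatVariance/Negative/LoadBearing.lean` (p145361): S1 is false for the frozen junk
dynamics (it needs `IsSolution` on an a.e. carrier) and for the Dirac-at-rest state (needs Gibbs moments /
`Var H_L → ∞` is used through S3), i.e. the line uses H = carrier-a.e. at S1 and H = Gibbs at S1/S3.
-/

noncomputable section

namespace Summit.AtomisticToContinuum.FouriersLaw.Cruxes.UnboundedHeatVariance.Relay

open MeasureTheory Set

/-! ## Part I — registered stubs (the lemmas of the line; `sorry` only here) -/

/-- **S1 — `stub_blockEnergyCaging` (block-energy increments are caged by the single-bond heat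
variance; size L, provable from the arena).** For every block `[-L, L]` and `τ ≥ 0`, the block energy
`H_L = Σ_{|x|≤L} h_x` is square integrable and `∫ (H_L∘φ_τ - H_L)² dμ ≤ 4 ∫ Q₀(τ)² dμ`, where
`Q₀(τ) = ∫₀^τ j₀∘φ_s ds` is the heat through bond `0`. Mechanism: the landed local conservation law
`ḣ_x = j_{x-1} - j_x` (`IsSolution.hasDerivAt_energyDensityZ`) integrated along the genuine orbits of the
a.e. carrier gives `H_L∘φ_τ - H_L = Q_{-L-1}(τ) - Q_L(τ)`; `‖Q_x(τ)‖₂ = ‖Q₀(τ)‖₂` by shift invariance and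
a.e. shift covariance; `(a-b)² ≤ 2a² + 2b²`; moments from
`hasSuperstabilityEstimate_of_isShiftInvariant_pinnedChain`, joint measurability of `(s,σ) ↦ j₀(φ_s σ)`
as in `InfiniteChainCurrentPositiveType`. [folklore; BonettoLebowitzReyBellet2000 §5.2 (23)] -/
theorem Holds.stub_blockEnergyCaging :
    ∀ ω₂ lam β γ : ℝ, 0 < ω₂ → 0 < lam → 0 < β → ∀ T : ℝ, 0 < T → ∀ μ : MeasureTheory.Measure Literature.MathematicalPhysics.KineticTheory.HeatConduction.ChainConfig, (Literature.MathematicalPhysics.KineticTheory.HeatConduction.pinnedChain ω₂ lam β γ).IsChainGibbsMeasure T μ → Literature.MathematicalPhysics.KineticTheory.HeatConduction.IsShiftInvariant μ → μ.map (fun σ : Literature.MathematicalPhysics.KineticTheory.HeatConduction.ChainConfig => fun x : ℤ => ((σ x).1, -(σ x).2)) = μ → ∀ D : Literature.MathematicalPhysics.KineticTheory.HeatConduction.InfiniteChainDynamics (Literature.MathematicalPhysics.KineticTheory.HeatConduction.pinnedChain ω₂ lam β γ), D.PreservesMeasure μ → (∀ t : ℝ, ∀ᵐ σ ∂μ, D.flow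 t (Literature.MathematicalPhysics.KineticTheory.HeatConduction.shift σ) = Literature.MathematicalPhysics.KineticTheory.HeatConduction.shift (D.flow t σ)) → (∀ t : ℝ, D.HasAbsConvergentCorrelation μ t) → Continuous (fun t : ℝ => D.currentCorrelation μ t) → ∀ (L : ℕ) (τ : ℝ), 0 ≤ τ → MeasureTheory.MemLp (fun σ : Literature.MathematicalPhysics.KineticTheory.HeatConduction.ChainConfig => ∑ x ∈ Finset.Icc (-(L : ℤ)) L, (Literature.MathematicalPhysics.KineticTheory.HeatConduction.pinnedChain ω₂ lam β γ).energyDensityZ σ x) 2 μ ∧ ∫ σ, (∑ x ∈ Finset.Icc (-(L : ℤ)) L, (Literature.MathematicalPhysics.KineticTheory.HeatConduction.pinnedChain ω₂ lam β γ).energyDensityZ (D.flow τ σ) x - ∑ x ∈ Finset.Icc (-(L : ℤ)) L, (Literature.MathematicalPhysics.KineticTheory.HeatConduction.pinnedChain ω₂ lam β γ).energyDensityZ σ x) ^ 2 ∂μ ≤ 4 * ∫ σ, (∫ s in (0:ℝ)..τ, (Literature.MathematicalPhysics.KineticTheory.HeatConduction.pinnedChain ω₂ lam β γ).bondCurrentZ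 (D.flow s σ) 0) ^ 2 ∂μ := by
  sorry

/-- **S2 — `stub_invariantNearCagedObservable` (an `L²` observable with caged forward increments is
close to a flow-invariant `L²` function; size M, provable, general Koopman geometry).** For any chain
`P`, any measure `μ` and any `μ`-preserving dynamics `D`: if `f ∈ L²(μ)` and
`∫ (f∘φ_τ - f)² dμ ≤ δ` for all `τ ≥ 0`, then some `g ∈ L²(μ)` with `g∘φ_t = g` a.e. for every `t` has
`∫ (f - g)² dμ ≤ δ`. Mechanism: in the Hilbert space `L²(μ)` the Koopman maps `U_s`, `s ≥ 0`, are linear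
isometries with `U_s U_t = U_{s+t}` (group law on the a.e. carrier, `InfiniteChainDynamics.flow_add`);
the closed convex hull `K` of the forward orbit `{U_τ f}` lies in the closed ball `B(f, √δ)` and is
`U_s`-stable; its unique point of minimal norm (`exists_norm_eq_iInf_of_complete_convex`) is therefore
`U_s`-fixed for `s ≥ 0`, and for `s < 0` by composing with `U_{-s}`. [folklore; von Neumann 1932 /
Alaoglu–Birkhoff mean ergodic circle of ideas] -/
theorem Holds.stub_invariantNearCagedObservable :
    ∀ (P : Literature.MathematicalPhysics.KineticTheory.HeatConduction.OscillatorChain) (μ : MeasureTheory.Measure Literature.MathematicalPhysics.KineticTheory.HeatConduction.ChainConfig) (D : Literature.MathematicalPhysics.KineticTheory.HeatConduction.InfiniteChainDynamics P), D.PreservesMeasure μ → ∀ f : Literature.MathematicalPhysics.KineticTheory.HeatConduction.ChainConfig → ℝ, MeasureTheory.MemLp f 2 μ → ∀ δ : ℝ, (∀ τ : ℝ, 0 ≤ τ → ∫ σ, (f (D.flow τ σ) - f σ) ^ 2 ∂μ ≤ δ) → ∃ g : Literature.MathematicalPhysics.KineticTheory.HeatConduction.ChainConfig → ℝ, MeasureTheory.MemLp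 g 2 μ ∧ (∀ t : ℝ, (fun σ => g (D.flow t σ)) =ᵐ[μ] g) ∧ ∫ σ, (f σ - g σ) ^ 2 ∂μ ≤ δ := by
  sorry

/-- **S3 — `stub_noFrozenBlockEnergy` (NO EXTENSIVE FROZEN ENERGY; the ergodic input, open).** In the
crux's arena, for every `M` there is a block `[-L, L]` whose energy `H_L` is farther than `√M` in `L²(μ)`
from EVERY flow-invariant square-integrable function: `∀ M ∃ L ∀ g ∈ L²(μ)`, `g∘φ_t = g` a.e. `∀ t` `⟹`
`M < ∫ (H_L - g)² dμ`. Equivalently `Var(H_L) - Var(E[H_L | ℐ_φ])` is unbounded in `L`: the conditional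
expectations of block energies on the invariant σ-algebra do not capture them up to `O(1)` — there is no
complete family of quasi-local `L²` integrals of motion ("classical l-bits"). Implied by (much weaker
than) ergodicity of `(μ_T, φ_t)`; a metric statement in `L²(μ_T)`, not the invariant-measure statement
`MacroErgodicityHypothesis`. Why it might fail: exactly in an insulating phase (Anderson-localised or a
genuinely many-body-localised clean chain: De Roeck–Huveneers' asymptotic localisation made permanent),
where `H_L` is `O(1)`-close to a sum of local conserved energies; ergodicity of infinite anharmonic
Hamiltonian dynamics in a Gibbs state is a "formidable unsolved problem" (Fritz–Funaki–Lebowitz 1994 §1).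
[DeRoeckHuveneers2015; FritzFunakiLebowitz1994 §1–2; LanfordLebowitz1975 (harmonic member: Bernoulli)] -/
theorem Holds.stub_noFrozenBlockEnergy :
    ∀ ω₂ lam β γ : ℝ, 0 < ω₂ → 0 < lam → 0 < β → ∀ T : ℝ, 0 < T → ∀ μ : MeasureTheory.Measure Literature.MathematicalPhysics.KineticTheory.HeatConduction.ChainConfig, (Literature.MathematicalPhysics.KineticTheory.HeatConduction.pinnedChain ω₂ lam β γ).IsChainGibbsMeasure T μ → Literature.MathematicalPhysics.KineticTheory.HeatConduction.IsShiftInvariant μ → μ.map (fun σ : Literature.MathematicalPhysics.KineticTheory.HeatConduction.ChainConfig => fun x : ℤ => ((σ x).1, -(σ x).2)) = μ → ∀ D : Literature.MathematicalPhysics.KineticTheory.HeatConduction.InfiniteChainDynamics (Literature.MathematicalPhysics.KineticTheory.HeatConduction.pinnedChain ω₂ lam β γ), D.PreservesMeasure μ → (∀ t : ℝ, ∀ᵐ σ ∂μ, D.flow t (Literature.MathematicalPhysics.KineticTheory.HeatConduction.shift σ) = Literature.MathematicalPhysics.KineticTheory.HeatConduction.shift (D.flow t σ)) → (∀ t : ℝ,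 D.HasAbsConvergentCorrelation μ t) → Continuous (fun t : ℝ => D.currentCorrelation μ t) → ∀ M : ℝ, ∃ L : ℕ, ∀ g : Literature.MathematicalPhysics.KineticTheory.HeatConduction.ChainConfig → ℝ, MeasureTheory.MemLp g 2 μ → (∀ t : ℝ, (fun σ => g (D.flow t σ)) =ᵐ[μ] g) → M < ∫ σ, (∑ x ∈ Finset.Icc (-(L : ℤ)) L, (Literature.MathematicalPhysics.KineticTheory.HeatConduction.pinnedChain ω₂ lam β γ).energyDensityZ σ x - g σ) ^ 2 ∂μ := by
  sorry

/-- **S4 — `stub_crossBondHeatCovariance` (the single-bond heat variance is affinely dominated by the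
total heat variance; open, kit-falsifiable).** In the crux's arena there is `K` with
`v(τ) = ∫ Q₀(τ)² dμ ≤ K (1 + V(τ))` for all `τ ≥ 0`, `V(τ) = 2∫_{(0,τ]} (τ-s) C(s) ds`. Since
`V - v = Σ_{x≠0} Cov(Q₀(τ), Q_x(τ))` (Green–Kubo–Helfand bond decomposition), this bounds the NET
cross-bond heat-transfer anticovariance; in spreading-profile form `v = Σ_d |d| ΔS(d,τ)`,
`V = Σ_d d² ΔS(d,τ)` (Mendl–Spohn 2015 (4.6); Helfand 1960) it follows from the DEP sign conjecture
`S(d,τ) ≥ 0` (card dynamical-energy-positivity-dep) with the static constant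
`K = 1 + Σ_{|d|≥2}(d²-|d|)S(d,0)`, and it holds at the harmonic member (Isserlis), in the kinetic regime
(positive phonon-Boltzmann kernel) and in the hydrodynamic regime (`V ≍ τ ≫ v ≍ √τ`). Why it might fail:
adjacent bond currents are statically ANTIcorrelated (`Cov(j₀,j₁) = (T/4)E[V'(r₀)V'(r₁)] < 0`), so
`V - v ≈ 2Cov(j₀,j₁)τ² < 0` at short times; a chain whose bond–bond heat-transfer covariance profile stays
net-negative (persistent neighbour 'sloshing', or sign-alternating cells growing with `v(τ)`) at a
sequence of times where `V` dips would violate it while U could still hold; beyond the harmonic/kinetic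
corners no lower bound on cross-bond covariances is in print. [Helfand1960; MendlSpohn2015
arXiv:1412.4609 §4 (4.6); Spohn1991 II §6.4; card dynamical-energy-positivity-dep] -/
theorem Holds.stub_crossBondHeatCovariance :
    ∀ ω₂ lam β γ : ℝ, 0 < ω₂ → 0 < lam → 0 < β → ∀ T : ℝ, 0 < T → ∀ μ : MeasureTheory.Measure Literature.MathematicalPhysics.KineticTheory.HeatConduction.ChainConfig, (Literature.MathematicalPhysics.KineticTheory.HeatConduction.pinnedChain ω₂ lam β γ).IsChainGibbsMeasure T μ → Literature.MathematicalPhysics.KineticTheory.HeatConduction.IsShiftInvariant μ → μ.map (fun σ : Literature.MathematicalPhysics.KineticTheory.HeatConduction.ChainConfig => fun x : ℤ => ((σ x).1, -(σ x).2)) = μ → ∀ D : Literature.MathematicalPhysics.KineticTheory.HeatConduction.InfiniteChainDynamics (Literature.MathematicalPhysics.KineticTheory.HeatConduction.pinnedChain ω₂ lam β γ), D.PreservesMeasure μ → (∀ t : ℝ, ∀ᵐ σ ∂μ, D.flow t (Literature.MathematicalPhysics.KineticTheory.HeatConduction.shift σ) = Literature.MathematicalPhysics.KineticTheory.HeatConduction.shift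 (D.flow t σ)) → (∀ t : ℝ, D.HasAbsConvergentCorrelation μ t) → Continuous (fun t : ℝ => D.currentCorrelation μ t) → ∃ K : ℝ, ∀ τ : ℝ, 0 ≤ τ → ∫ σ, (∫ s in (0:ℝ)..τ, (Literature.MathematicalPhysics.KineticTheory.HeatConduction.pinnedChain ω₂ lam β γ).bondCurrentZ (D.flow s σ) 0) ^ 2 ∂μ ≤ K * (1 + 2 * ∫ s in Set.Ioc (0:ℝ) τ, (τ - s) * D.currentCorrelation μ s) := by
  sorry

/-! ### By-name handles of the four statements (no second copy of the text) -/

/-- Statement of registered stub S1 (`Holds.stub_blockEnergyCaging`), by name. -/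
def stub_blockEnergyCaging : Prop := type_of% Holds.stub_blockEnergyCaging

/-- Statement of registered stub S2 (`Holds.stub_invariantNearCagedObservable`), by name. -/
def stub_invariantNearCagedObservable : Prop := type_of% Holds.stub_invariantNearCagedObservable

/-- Statement of registered stub S3 (`Holds.stub_noFrozenBlockEnergy`), by name. -/
def stub_noFrozenBlockEnergy : Prop := type_of% Holds.stub_noFrozenBlockEnergy

/-- Statement of registered stub S4 (`Holds.stub_crossBondHeatCovariance`), by name. -/
def stub_crossBondHeatCovariance : Prop := type_of% Holds.stub_crossBondHeatCovariance

/-! ## Part II — the skeleton theorem: the four stubs give the crux BY NAME (sorry-free) -/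

/-- **`UnboundedHeatVariance_of`** — `stub_blockEnergyCaging → stub_invariantNearCagedObservable →
stub_noFrozenBlockEnergy → stub_crossBondHeatCovariance → CageBudgetFekete.UnboundedHeatVariance`
(kernel-checked; logic plus linear arithmetic: a bounded total heat variance cages the single-bond one
(S4), hence every block energy (S1), hence puts every block energy near an invariant function (S2),
against S3). [folklore] -/
theorem UnboundedHeatVariance_of (h₁ : stub_blockEnergyCaging) (h₂ : stub_invariantNearCagedObservable)
    (h₃ : stub_noFrozenBlockEnergy) (h₄ : stub_crossBondHeatCovariance) :
    _root_.Summit.AtomisticToContinuum.FouriersLaw.Theses.CageBudgetFekete.UnboundedHeatVariance := by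
  intro ω₂ lam β γ hω hl hβ T hT μ hG hSI hRefl D hP hShift hAC hCc V hV R
  -- S4: the cross-bond covariance constant
  obtain ⟨K, hK⟩ := h₄ ω₂ lam β γ hω hl hβ T hT μ hG hSI hRefl D hP hShift hAC hCc
  by_contra hcon
  push Not at hcon
  -- hcon : ∀ τ, 0 ≤ τ → V τ ≤ R
  -- the single-bond heat variance
  set v : ℝ → ℝ := fun τ => ∫ σ, (∫ s in (0:ℝ)..τ,
    (Literature.MathematicalPhysics.KineticTheory.HeatConduction.pinnedChain ω₂ lam β γ).bondCurrentZ
      (D.flow s σ) 0) ^ 2 ∂μ with hv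
  have hVexp : ∀ τ : ℝ, V τ = 2 * ∫ s in Set.Ioc (0:ℝ) τ, (τ - s) * D.currentCorrelation μ s :=
    fun τ => by simp only [hV]
  have hv0 : ∀ τ, 0 ≤ v τ := fun τ => integral_nonneg fun σ => sq_nonneg _
  have hK' : ∀ τ : ℝ, 0 ≤ τ → v τ ≤ K * (1 + V τ) := by
    intro τ hτ
    have := hK τ hτ
    rw [hVexp τ]
    exact this
  -- the cage: v ≤ K (1 + R) on τ ≥ 0
  have hV00 : V 0 = 0 := by
    rw [hVexp 0]
    simp
  have hKnn : 0 ≤ K := by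
    have h10 := hK' 0 le_rfl
    rw [hV00] at h10
    have := hv0 0
    linarith
  have hcage : ∀ τ : ℝ, 0 ≤ τ → v τ ≤ K * (1 + R) := by
    intro τ hτ
    have h2 : V τ ≤ R := hcon τ hτ
    calc v τ ≤ K * (1 + V τ) := hK' τ hτ
      _ ≤ K * (1 + R) := by
          apply mul_le_mul_of_nonneg_left _ hKnn
          linarith
  set δ : ℝ := 4 * (K * (1 + R)) with hδ
  -- S1 + S2: every block energy is within δ of an invariant L² function
  have hnear : ∀ L : ℕ, ∃ g : Literature.MathematicalPhysics.KineticTheory.HeatConduction.ChainConfig → ℝ,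
      MeasureTheory.MemLp g 2 μ ∧ (∀ t : ℝ, (fun σ => g (D.flow t σ)) =ᵐ[μ] g) ∧
      ∫ σ, ((∑ x ∈ Finset.Icc (-(L : ℤ)) L,
        (Literature.MathematicalPhysics.KineticTheory.HeatConduction.pinnedChain ω₂ lam β γ).energyDensityZ σ x)
          - g σ) ^ 2 ∂μ ≤ δ := by
    intro L
    have hS1 := h₁ ω₂ lam β γ hω hl hβ T hT μ hG hSI hRefl D hP hShift hAC hCc L
    have hmem : MeasureTheory.MemLp (fun σ => ∑ x ∈ Finset.Icc (-(L : ℤ)) L,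
        (Literature.MathematicalPhysics.KineticTheory.HeatConduction.pinnedChain ω₂ lam β γ).energyDensityZ σ x)
        2 μ :=
      (hS1 0 le_rfl).1
    refine h₂ (Literature.MathematicalPhysics.KineticTheory.HeatConduction.pinnedChain ω₂ lam β γ) μ D hP
      (fun σ => ∑ x ∈ Finset.Icc (-(L : ℤ)) L,
        (Literature.MathematicalPhysics.KineticTheory.HeatConduction.pinnedChain ω₂ lam β γ).energyDensityZ σ x)
      hmem δ ?_
    intro τ hτ
    have hinc := (hS1 τ hτ).2
    have hvτ := hcage τ hτ
    calc ∫ σ, ((∑ x ∈ Finset.Icc (-(L : ℤ)) L,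
              (Literature.MathematicalPhysics.KineticTheory.HeatConduction.pinnedChain ω₂ lam β γ).energyDensityZ
                (D.flow τ σ) x) -
            ∑ x ∈ Finset.Icc (-(L : ℤ)) L,
              (Literature.MathematicalPhysics.KineticTheory.HeatConduction.pinnedChain ω₂ lam β γ).energyDensityZ
                σ x) ^ 2 ∂μ
          ≤ 4 * v τ := hinc
      _ ≤ 4 * (K * (1 + R)) := by linarith
  -- S3 at M = δ: some block is far from every invariant function
  obtain ⟨L, hL⟩ := h₃ ω₂ lam β γ hω hl hβ T hT μ hG hSI hRefl D hP hShift hAC hCc δ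
  obtain ⟨g, hg2, hginv, hgnear⟩ := hnear L
  have hfar := hL g hg2 hginv
  linarith

/-- D-0027 §3.3 shape: the crux from the registered stubs (an `example`, so that
`UnboundedHeatVariance_of` stays the unique theorem concluding the crux; it becomes a proof once the
four `sorry`s are discharged). -/
example : _root_.Summit.AtomisticToContinuum.FouriersLaw.Theses.CageBudgetFekete.UnboundedHeatVariance :=
  UnboundedHeatVariance_of Holds.stub_blockEnergyCaging Holds.stub_invariantNearCagedObservable
    Holds.stub_noFrozenBlockEnergy Holds.stub_crossBondHeatCovariance

end Summit.AtomisticToContinuum.FouriersLaw.Cruxes.UnboundedHeatVariance.Relay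

end
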